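import Summits.BirchSwinnertonDyer.BirchSwinnertonDyer.Theorems.KolyvaginRoadThreeMethod2Defs
import Summits.BirchSwinnertonDyer.Rank1Residual.X11b.Three.KolyvaginLine
import Literature.NumberTheory.EllipticCurves.ZhangLevelRaisedHeegnerData
import Literature.NumberTheory.EllipticCurves.HeegnerPointsKolyvaginPairing
import Literature.NumberTheory.GaloisRepresentations.IntegralGaloisAction
import HarnessLib

/-!
# KOLY method line, crux stmt-BirchSwinnertonDyer-19574 `ZhangSharpFrameAtThreeHL`: the vocabulary of the S2 RE-LINE
# — the TRANSVERSE local condition at a Kolyvagin prime and W. Zhang's LEVEL KOLYVAGIN SYSTEMS as pinned-shape data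
# (route `KolyvaginRoadThree`; cell `bsd-stepL`, seat `bsd-stepL-zhang3-p1` g8; definitions, `--supports 19574`;
# asked by plan g30 2026-08-27T03:49:37Z «S2 re-line … hand me the stub signatures»)

Vocabulary only (no mathematics is asserted). Two objects:

* `transverseLocalKer W K ι ℓ v ≤ H¹(K, E[3])` — the classes whose localisation at the place `v ∋ ℓ` is TRANSVERSE
  (W. Zhang 2014 §8.1: `H¹(K_ℓ, V) = H¹_fin ⊕ H¹_tr`, *"the transverse part `H¹_tr = H¹(K[ℓ]_λ/K_λ, V)`"* inflated from
  the completed ring class field; Kolyvagin ∕ McCallum 1991 §4: the classes split by `K[ℓ]_λ`), in the tree's GLOBAL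
  Gross-currency (a subgroup of `H¹(K, E[3])`, like `selmerLocalKer` ∕ `torsionLocalKer` ∕ `ordinaryLocalKer`): `x` is
  transverse at `v` iff its cocycle VANISHES on `D_𝔓 ∩ Gal(K̄/K[ℓ])` for every prime `𝔓` of `ℤ̄_K` above `v` — the
  decomposition group of `K[ℓ]` at `𝔓`, whose image in `Gal(K_λ^{ab}/K_λ) ⊗ 𝔽₃` is the line of the norm group of the
  totally ramified `K[ℓ]_λ/K_λ` (values `h1Eval` at elements fixing `E[3]`, where the cocycle is a homomorphism; at a
  Kolyvagin prime `D_𝔓` fixes `E[3]`). No local cohomology group, pairing or completion of `K[ℓ]` is needed to STATE it.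
* `LevelKolyvaginSystem W K Dt β ι c` — the conjuncts of the proposed residual stub S2-KS of the S2 re-line as ONE
  structure over the tree's `Method2Defs` objects (`V3`, `IsUAdmissiblePrime`, `GoodLevel`, `SelQ`, `baseLocusQ`) and
  Zhang's Kolyvagin primes (`Zhang2014.IsKolyvaginPrime`): classes `κ m n ∈ H¹(K, E[3])` for `m` a finite set of
  Kolyvagin primes (conductor `∏ m`) and `n` a finite set of unipotent-admissible primes (level `N ∏ n`), a sign
  `ε₀ n` per level, with — REALISATION at `n = ∅` (the frame's concrete Kolyvagin classes mod 3, for some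
  Kolyvagin–Heegner datum of conductor `∏ m`); at every GOOD NON-EMPTY level the KOLYVAGIN-SYSTEM AXIOMS for the
  level-`n` structure [Zhang §8.1 property (1) + (8.1): sign `ε₀ n · (−1)^{#m}`; E's Kummer condition at the infinite
  places and at the finite places above no prime of `m ∪ n`; ORDINARY at the places of `n`; TRANSVERSE at the places
  of `m`; `loc_ℓ κ(mℓ, n) = 0 ⟺ loc_ℓ κ(m, n) = 0`]; (A2) congruence TRANSPORT along two good steps [Thm 4.3]; and the
  (A5) BASE CASE at good non-empty even levels of canonical rank one [Thm 7.2]. EXACTLY the binders `κ`, `hcE`, `hcL`,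
  `hcT`, `hfs`, `hA2`, `hA5` of the engine-of-KS `ZhangTriangulation.exists_ne_zero_of_zhangInduction_on_of_
  kolyvaginSystem_finite` (p493797) read in the model, and nothing else: the engine's level-INDEPENDENT inputs ((REC),
  (Cheb), (Supply), (Perf) ∕ (Line) ∕ (Iso), the membership dictionaries) are NOT fields — they are the PROVABLE content
  of the companion stub S2-ENGINE. `Nonempty (LevelKolyvaginSystem …)` at every HL A1 frame is the proposed S2-KS
  (W. Zhang §3 + Thm 4.3 + Thm 7.2 run at `p = 3`: not in print, the crux's residual content above the bottom).

HONEST FRAMING: definitions with bodies + one repackaging theorem; 0 named facts, 0 `sorry`, no instance, no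
notation; nothing is asserted to exist; closes nothing (T7). PARTITION: O2@3 (B10) × A1 × crux 19574 × stub S2 —
types-the-object-of (vocabulary for the re-line).

References: [cite: WZhang2014, §3.7 (3.20)–(3.22), §8.1 property (1), (8.1), Def. 8.3, Thm. 4.3, Thm. 7.2, §9]
[cite: GrossLMS1991, §3 (K_ℓ totally ramified at λ), §4 (4.4), Prop. 6.2] [cite: McCallumLMS1991, §4 (H¹_f ⊕ H¹_s)].
-/

noncomputable section

open scoped Classical

namespace Summit.BirchSwinnertonDyer.Rank1Residual.X11b.Three.Koly.Method2

open WeierstrassCurve NumberField IsDedekindDomain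
  Literature.NumberTheory.EllipticCurves Literature.NumberTheory.EllipticCurves.ModularForms
  Literature.NumberTheory.GaloisRepresentations Module

variable (W : WeierstrassCurve ℚ) (K : Type) [Field K] [NumberField K]

/-- **The TRANSVERSE local condition at `ℓ`** (W. Zhang 2014, §8.1: `H¹_tr(K_ℓ, V) ⊂ H¹(K_ℓ, V)`, the classes
inflated from the completed ring class field `K[ℓ]_λ/K_λ`; Gross 1991 §3: `λ` is totally ramified in `K_ℓ = K[ℓ]`):
the subgroup of `H¹(K, E[3])` of classes `x` whose cocycle value `[x, d]` (tree `h1Eval`) vanishes at every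
`d ∈ Gal(K̄/K)` lying in the decomposition group of a prime `𝔓 ∣ v` of `ℤ̄_K`, in `Gal(K̄/K[ℓ])` (tree
`ringClassStabilizer K ι ℓ ℓ`, `ι` the complex embedding of the frame) and in `Gal(K̄/K(E[3]))` (where `[x, ·]` is a
homomorphism; automatic on `D_𝔓` at a Kolyvagin prime, `Frob_λ = τ² = 1` on `E[3]`). Meant for `v` the place of a
Kolyvagin prime `ℓ`; junk elsewhere. [cite: WZhang2014, §8.1 (H¹_tr)] [cite: GrossLMS1991, §3–§4] -/
def transverseLocalKer (ι : K →+* ℂ) (ℓ : ℕ) (v : HeightOneSpectrum (𝓞 K)) : AddSubgroup (V3 W K) where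
  carrier := {x | ∀ 𝔓 ∈ v.primesAbove, ∀ d : Field.absoluteGaloisGroup K,
    d ∈ 𝔓.decompositionSubgroup (Field.absoluteGaloisGroup K) → d ∈ ringClassStabilizer K ι ℓ ℓ →
    d ∈ torsionFixing (W.baseChange K) ((3 ^ 1 : ℕ) : ℤ) →
    h1Eval (W.baseChange K) ((3 ^ 1 : ℕ) : ℤ) x d = 0}
  zero_mem' := fun _ _ _ _ _ hd ↦ h1Eval_zero (W.baseChange K) _ hd
  add_mem' := fun {x y} hx hy 𝔓 h𝔓 d hdD hdS hdT ↦ by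
    rw [h1Eval_add (W.baseChange K) _ x y hdT, hx 𝔓 h𝔓 d hdD hdS hdT, hy 𝔓 h𝔓 d hdD hdS hdT, add_zero]
  neg_mem' := fun {x} hx 𝔓 h𝔓 d hdD hdS hdT ↦ by
    rw [h1Eval_neg (W.baseChange K) _ x hdT, hx 𝔓 h𝔓 d hdD hdS hdT, neg_zero]

variable {W K} in
/-- Membership in the transverse condition (definitional). [cite: WZhang2014, §8.1 (H¹_tr)] -/
theorem mem_transverseLocalKer_iff {ι : K →+* ℂ} {ℓ : ℕ} {v : HeightOneSpectrum (𝓞 K)} {x : V3 W K} :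
    x ∈ transverseLocalKer W K ι ℓ v ↔ ∀ 𝔓 ∈ v.primesAbove, ∀ d : Field.absoluteGaloisGroup K,
      d ∈ 𝔓.decompositionSubgroup (Field.absoluteGaloisGroup K) → d ∈ ringClassStabilizer K ι ℓ ℓ →
      d ∈ torsionFixing (W.baseChange K) ((3 ^ 1 : ℕ) : ℤ) →
      h1Eval (W.baseChange K) ((3 ^ 1 : ℕ) : ℤ) x d = 0 :=
  Iff.rfl

variable [W.IsElliptic] [W.IsGloballyMinimal] [NeZero (W.conductorNorm ℤ)]
  (Dt : ModularParametrizationData W (W.conductorNorm ℤ)) (β : ℤ) (ι : K →+* ℂ) (c : K ≃ₐ[ℚ] K)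
  [Module (ZMod 3) (V3 W K)]

/-- **W. Zhang's LEVEL KOLYVAGIN SYSTEMS at `p = 3` as pinned-shape data** (the body of the proposed residual stub
S2-KS of the S2 re-line of crux 19574). Indices: `m` a finite set of Kolyvagin primes (`Zhang2014.IsKolyvaginPrime`,
conductor `∏ m ∈ Λ`), `n` a finite set of unipotent-admissible primes (level `N·∏ n`). Fields: the classes
`κ m n ∈ H¹(K, E[3])` (Zhang's `c(∏m, ∏n)`, (3.30)) and level signs `ε₀`; `realisation` (at level `∅` the classes ARE
the frame's Kolyvagin classes mod 3); at every GOOD NON-EMPTY level the Kolyvagin-system axioms for the level-`n`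
structure — `sign` (Prop 5.4 (2) shape), `selmer_off` ∕ `selmer_inf` ∕ `ordinary_on` (property (1) off the support:
E's Kummer condition off `m ∪ n`, the ORDINARY condition on `n` = the conditions of `levelSelmerSubgroup`),
`transverse_on` (property (1)
on the support), `relation` ((8.1) as used: `loc_ℓ κ(mℓ, n) = 0 ⟺ loc_ℓ κ(m, n) = 0`); `transport` ((A2), Thm 4.3,
contrapositive transport form of the engine); `baseCase` ((A5), Thm 7.2 at good non-empty even levels of canonical rank
one, bottom conductor `m = ∅`). These are VERBATIM the level-dependent binders of the engine-of-KS (`…_finite`, p493797)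
read in the model; existence is NOT claimed. [cite: WZhang2014, §3.9 (3.30), §8.1, Thm. 4.3, Thm. 7.2, §9] -/
structure LevelKolyvaginSystem where
  /-- the sign of the conductor-one class at level `n` (`c(1, n) ∈ H¹(K, V)^{ε₀ n}`) -/
  ε₀ : Finset {q // IsUAdmissiblePrime W K q} → Bool
  /-- the classes `c(∏ m, ∏ n) ∈ H¹(K, E[3])` -/
  κ : Finset {ℓ // Zhang2014.IsKolyvaginPrime (W.conductorNorm ℤ) W K 3 ℓ} →
    Finset {q // IsUAdmissiblePrime W K q} → V3 W K
  /-- REALISATION: at level `∅` the classes are the frame's Kolyvagin classes mod 3 (for some Kolyvagin–Heegner datum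
  of conductor `∏ m`; non-vanishing does not depend on the choices). -/
  realisation : ∀ m : Finset {ℓ // Zhang2014.IsKolyvaginPrime (W.conductorNorm ℤ) W K 3 ℓ},
    ∃ d : KolyvaginHeegnerData Dt β ι (∏ ℓ ∈ m, (ℓ : ℕ)),
    κ m ∅ = d.kolyvaginClass Nat.prime_three 1
  /-- SIGN: `κ m n` lies in the `ε₀ n · (−1)^{#m}`-eigenspace of complex conjugation. -/
  sign : ∀ n, GoodLevel W K n → n.Nonempty →
    ∀ m : Finset {ℓ // Zhang2014.IsKolyvaginPrime (W.conductorNorm ℤ) W K 3 ℓ},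
    conjAct W c ((3 ^ 1 : ℕ) : ℤ) (κ m n) = sgn (ε₀ n ^^ Nat.bodd m.card) • κ m n
  /-- property (1) off the support, finite places: E's Kummer condition above no prime of `m ∪ n`. -/
  selmer_off : ∀ n, GoodLevel W K n → n.Nonempty →
    ∀ (m : Finset {ℓ // Zhang2014.IsKolyvaginPrime (W.conductorNorm ℤ) W K 3 ℓ}) (v : HeightOneSpectrum (𝓞 K)),
    (∀ ℓ ∈ m, ((ℓ : ℕ) : 𝓞 K) ∉ v.asIdeal) → (∀ q ∈ n, ((q : ℕ) : 𝓞 K) ∉ v.asIdeal) →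
    κ m n ∈ selmerLocalKer (W.baseChange K) (v.adicCompletion K) ((3 ^ 1 : ℕ) : ℤ)
  /-- property (1) off the support, infinite places. -/
  selmer_inf : ∀ n, GoodLevel W K n → n.Nonempty →
    ∀ (m : Finset {ℓ // Zhang2014.IsKolyvaginPrime (W.conductorNorm ℤ) W K 3 ℓ}) (w : InfinitePlace K),
    κ m n ∈ selmerLocalKer (W.baseChange K) w.Completion ((3 ^ 1 : ℕ) : ℤ)
  /-- property (1) at the level: ORDINARY at the places of `n`. -/
  ordinary_on : ∀ n, GoodLevel W K n → n.Nonempty →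
    ∀ m : Finset {ℓ // Zhang2014.IsKolyvaginPrime (W.conductorNorm ℤ) W K 3 ℓ}, ∀ q ∈ n, ∀ v : HeightOneSpectrum (𝓞 K),
    ((q : ℕ) : 𝓞 K) ∈ v.asIdeal → κ m n ∈ (W.baseChange K).ordinaryLocalKer (v.adicCompletion K) ((3 ^ 1 : ℕ) : ℤ)
  /-- property (1) on the support: TRANSVERSE at the places of `m`. -/
  transverse_on : ∀ n, GoodLevel W K n → n.Nonempty →
    ∀ m : Finset {ℓ // Zhang2014.IsKolyvaginPrime (W.conductorNorm ℤ) W K 3 ℓ}, ∀ ℓ ∈ m, ∀ v : HeightOneSpectrum (𝓞 K),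
    ((ℓ : ℕ) : 𝓞 K) ∈ v.asIdeal → κ m n ∈ transverseLocalKer W K ι ℓ v
  /-- (8.1) as used: `loc_ℓ κ(mℓ, n) = 0 ⟺ loc_ℓ κ(m, n) = 0`. -/
  relation : ∀ n, GoodLevel W K n → n.Nonempty →
    ∀ (m : Finset {ℓ // Zhang2014.IsKolyvaginPrime (W.conductorNorm ℤ) W K 3 ℓ})
      (ℓ : {ℓ // Zhang2014.IsKolyvaginPrime (W.conductorNorm ℤ) W K 3 ℓ}), ℓ ∉ m → ∀ v : HeightOneSpectrum (𝓞 K),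
    ((ℓ : ℕ) : 𝓞 K) ∈ v.asIdeal →
    (κ (insert ℓ m) n ∈ (W.baseChange K).torsionLocalKer (v.adicCompletion K) ((3 ^ 1 : ℕ) : ℤ) ↔
      κ m n ∈ (W.baseChange K).torsionLocalKer (v.adicCompletion K) ((3 ^ 1 : ℕ) : ℤ))
  /-- (A2) congruence TRANSPORT along two good steps (Zhang Thm 4.3, contrapositive form). -/
  transport : ∀ (n : Finset {q // IsUAdmissiblePrime W K q}) (q₁ q₂ : {q // IsUAdmissiblePrime W K q}),
    GoodLevel W K n → GoodLevel W K (insert q₁ n) → GoodLevel W K (insert q₂ (insert q₁ n)) →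
    q₁ ∉ n → q₂ ∉ insert q₁ n → q₂ ∉ baseLocusQ W K κ (insert q₂ (insert q₁ n)) → ∃ m, κ m n ≠ 0
  /-- (A5) BASE CASE at good non-empty even levels of canonical rank one (Zhang Thm 7.2): `c(1, n) ≠ 0`. -/
  baseCase : ∀ n, GoodLevel W K n → n.Nonempty → Even n.card →
    finrank (ZMod 3) (SelQ W K c n true) + finrank (ZMod 3) (SelQ W K c n false) = 1 → κ ∅ n ≠ 0

end Summit.BirchSwinnertonDyer.Rank1Residual.X11b.Three.Koly.Method2

end
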